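import Literature.NumberTheory.EllipticCurves.ModularCurve
import Literature.NumberTheory.EllipticCurves.QuadraticTwist
import Literature.NumberTheory.EllipticCurves.Isogeny
import Literature.NumberTheory.EllipticCurves.GlobalMinimalModel
import Literature.NumberTheory.DiophantineGeometry.Conductor
import HarnessLib
import HarnessLib.Audit.Tags

/-!
# Candidates E-imc-12 / E-imc-13 / E-imc-14: the ISOGENY-EDGE LAWS of the Manin `p`-part across an
# isogeny class with an additive prime — `RootEdgeGainOnlyByDrop p`, `RelativeManinTrivialityGeFive p`,
# `NonSquarefreeNoTameGain q` — cell `bsd-f2-manin` (D-0131 (3) frontier: the Manin constant at additive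
# primes). `@[conjecture]` leaf (NOTHING asserted; definitions only; the proved glue edge lives in
# `IsogenyEdgeLawsEdges.lean`).

HONEST FRAMING. LENS = Iwasawa-main-conjecture / Λ-adic–Raynaud integrality read as the `p`-ISOGENY
NÉRON-SCALAR LAW and the GLOBAL ISOGENY-EDGE CENSUS of Manin gains (planner-of-record `bsd-f2-manin-imc` g3,
HOME `run/shared/lean/pub/bsd-f2-manin/MEMO-imc.md` §11; Props VERBATIM from HOME/imc/Sketch-imc-g3.lean
sha16 187cb8cf2cd306de, namespace `BsdF2ManinImc`, farm rc 0 · 0 sorries · 0 warnings; the lattice clause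
`Λ_W = c·Λ_f` inlined as in every `ManinAdditive` leaf).  DICTIONARY: the only integrality statement of the
family programme surviving at an additive prime is RAYNAUD's `e < p − 1` prolongation lemma, which
Dokchitser–Dokchitser use to compute the Néron scalar `λ(ψ) := ψ*ω′/ω ∈ {1, p}` of a `p`-isogeny
`ψ : E → E′` (Table 1 / Props 15–18), EXCEPT in the potentially supersingular additive rows (their «?»);
the cell's THEOREM T1 (paper proof MEMO-imc §11.2; in print in substance as Klagsbrun 2017 Thm 1 +
Dokchitser–Dokchitser Lemma 12 per refuter-2 R-imc-7 — it is E-imc-11, NOT typed here: a Literature item)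
decides the «?» by the minimal discriminants: a DROP of `v_p Δ_min` along `ψ` forces `v_p(λ) = 1`, a RISE
forces `v_p(λ) = 0`; in Manin form `c(ψ ∘ φ₀) = λ(ψ)·c(φ₀)`.  The three laws below are what the census
shows BEYOND T1.  CONFIGURATION (all three): `W`, `W₂` globally minimal, `D` the LATTICE-OPTIMAL
`X₀(N)`-datum of `W` at the conductor level `N = N(W)` (so `W = E₀`, refuter-1 traps T1/T2/T3 present),
`D₂` an `X₀(N)`-datum of `W₂` at the same level, an isogeny `φ : W → W₂` (tree `WeierstrassCurve.Isogeny`,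
`.degree`); `v_p` of the Manin constants via `padicValInt`.

BC5 WITNESS = the cell census HOME/imc/g3-isolaw.py 6de28e1603f43826 → g3-isolaw-ALL.out b3d983496c0c8517,
g3-isolaw-ALL-rows.tsv b4c9bef337aa87b1 (Cremona ecdata `allisog` + `opt_man`, `N < 5·10⁵`: 2 164 259 classes,
913 507 prime-degree isogeny edges oriented away from the `X₀(N)`-optimal curve by minimal degree, 269 curves
with `c ≠ 1`), independently re-run by refuter-1 (HOME/REFUTER-ref1.md §R10, 17:48Z): VIOLATIONS 0 for all
three rows; caveat carried (MEMO-imc §12.9): 67 326 root edges at `N > 4·10⁵` rest on uncertified «#1»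
optimality labels — 1 proven label error (390150gy, E-imc-19) / 935 907 `p`-semistable twist edges.
NOT IN PRINT (refuter-2 g3, HOME/REFUTER-ref2.md R-imc-7/8, ref2/LIT-PLACEMENT v4 §B⁗): nearest printed
statements are Stevens 1989 Conj. II + Remark (`E₁ = E₀/(E₀ ∩ Σ)`), Vatsal 2005 Thms 1.10/1.11 (semistable /
`ℓ ≥ 7` ordinary) and Rem. 1.8 / Conj. 1.9, Byeon–Yhee 2013 Thm 1.1(ii) (squarefree `N`), Ling–Oesterlé 1991
(Shimura subgroup); Klagsbrun 2017 / Dokchitser–Dokchitser 2015 decide `λ` per edge, not which end is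
`X₀(N)`-optimal; Česnavičius–Neururer–Saha reach class members only through `v_p c ≤ v_p deg φ`.
Refuter verdicts: REF1 **SURVIVES ×3** (§R10.3–10.5; BC7 CLEAN; read-back: `φ` decorative in 13/14,
`j = 0` admitted, T1 sign-only valid at 2, 3); REF2 **NOT-IN-PRINT / OPEN-NEW (TABLE-TRUE)** ×3;
planner-of-record: T-imc-7 GO (17:53Z).
-/

noncomputable section

open scoped MatrixGroups ModularForm

open CongruenceSubgroup WeierstrassCurve
  Literature.NumberTheory.EllipticCurves Literature.NumberTheory.EllipticCurves.ModularForms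

namespace Summit.BirchSwinnertonDyer.Rank1Residual.ManinAdditive

/-- **Candidate E-imc-12 `RootEdgeGainOnlyByDrop p` (cell bsd-f2-manin, MEMO-imc §11; the ROOT-EDGE LAW at
a BAD prime — a LAW, NOT in print, nothing asserted):** for a prime `p ∣ N(W)` (multiplicative or additive,
any `p`), `W`, `W₂` globally minimal, `D` the lattice-optimal `X₀(N(W))`-datum of `W`, `D₂` a datum of `W₂`
at the same level with `deg D₂ = p · deg D`, and an isogeny `φ : W → W₂` of degree `p`: the Manin `p`-part
does NOT grow along `φ` — `v_p c(D₂) = v_p c(D)` — UNLESS `W` is potentially good at `p` (`0 ≤ v_p j(W)`)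
and `v_p Δ_min` DROPS (the T1 / E-imc-11 mechanism, excluded by the hypothesis).  Content beyond theorems:
level potentially-good edges (27 612 / 27 612 with gain 0, 18 341 of them out of `E₀`) and the absence of
`Δ_min`-RISING edges out of `E₀` at (potentially) multiplicative `p` (0 of 85 097 / 323 244; a rise would
force a gain by the Tate-curve rule, Dokchitser–Dokchitser Prop. 18).  BC5: 564 312 root edges at bad `p`,
0 violations (refuter-1 §R10.3).  Why it might fail: a potentially-ordinary LEVEL edge at `(p, e) = (5, 4)`
or `(7, 6)`, where inertia does not forbid `μ_p ⊂ E₀` (1 459 + 429 such edges in range, 0 gains), or a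
`Γ₀(N)`-optimal curve on the toric side of a multiplicative `p`-isogeny beyond `5·10⁵`.
[cite: Vatsal2005, Rem. 1.8, Conj. 1.9 and Thms 1.10–1.11 (shape only: for p ∣ N the optimal curve meets the Shimura subgroup trivially at p except through wild lattice drops — the all-p, all-bad-type root-edge law is NOT in print; cell bsd-f2-manin MEMO-imc.md §11, E-imc-12)]
[cite: DokchitserDokchitser2015LocalInvariants, Table 1, Lemma 12, Props 15–18 (the Néron scalar λ(ψ) ∈ {1, p} per edge)] -/
@[conjecture] def RootEdgeGainOnlyByDrop (p : ℕ) : Prop :=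
  ∀ (W W₂ : WeierstrassCurve ℚ) [W.IsElliptic] [W.IsGloballyMinimal] [W₂.IsElliptic]
    [W₂.IsGloballyMinimal] [NeZero (W.conductorNorm ℤ)]
    (D : ModularParametrizationData W (W.conductorNorm ℤ))
    (D₂ : ModularParametrizationData W₂ (W.conductorNorm ℤ)) (φ : WeierstrassCurve.Isogeny W W₂),
    p.Prime → (∀ z ∈ D.L.lattice, ∃ w ∈ periodLattice D.f, z = D.c * w) →
    φ.degree = p → D₂.deg = p * D.deg → (p : ℤ) ∣ W.conductorNorm ℤ →
    ¬ (0 ≤ padicValRat p W.j ∧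
        padicValInt p W₂.minimalDiscriminantInt < padicValInt p W.minimalDiscriminantInt) →
      padicValInt p D₂.c = padicValInt p D.c

/-- **Candidate E-imc-13 `RelativeManinTrivialityGeFive p` (cell bsd-f2-manin, MEMO-imc §11; a LAW, NOT in
print, nothing asserted):** at an ADDITIVE prime `p ≥ 5` (`p² ∣ N(W)`) the Manin `p`-part is CONSTANT on
the isogeny class relative to the optimal curve: `W`, `W₂` globally minimal and isogenous (`_φ`, any degree;
decorative — it records that `W₂` is in the class), `D` the lattice-optimal datum of `W` at its conductor,
`D₂` a MINIMAL-DEGREE datum of `W₂` at the same level ⇒ `v_p c(D₂) = v_p c(D)`.  With Mazur-type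
`c(E₀) = 1` this is «`p ∤ c_E` for every `E` of the class» at additive `p ≥ 5` — for NON-optimal members no
printed theorem gives it (Česnavičius–Neururer–Saha bound `v_p c ≤ v_p deg φ` only).  Mechanism: additive
potentially good reduction at `p ≥ 5` is tame, `Δ_min`-drops out of `E₀` do not occur (E-imc-5
`OptimalUnstarredAcrossIsogeny`: 0 / 1 930 moves), T1 (E-imc-11) kills rises, level edges are E-imc-12,
potentially multiplicative edges are Tate drops.  BC5: 354 070 (curve, p) incidences at additive `p ≥ 5`,
0 violations; 3 975 potentially-good + 534 potentially-multiplicative edges at additive `p ≥ 5`, gain `0` in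
every one (p = 5: 3 117 + 492, 7: 724 + 42, 11: 37, 13: 24, 17: 20, 19: 23, 43: 11, 67: 7, 163: 3)
(refuter-1 §R10.4).  Why it might fail: the level potentially-ordinary edges at `(5, e = 4)`, `(7, e = 6)`,
or a class whose optimal curve is the starred end of a `Δ`-moving edge (contradicting E-imc-5).
[cite: EdixhovenManin1991, Thm. 3 (shape only: p ≥ 11 ⇒ p ∤ c(E₀) for the OPTIMAL curve; the class-wide constancy of the Manin p-part at additive p ≥ 5 is NOT in print — cell bsd-f2-manin MEMO-imc.md §11, E-imc-13; ref2: = [MH′] ∧ (p ≥ 5), table-true)]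
[cite: DokchitserDokchitser2015LocalInvariants, Table 1 and Props 15–18] -/
@[conjecture] def RelativeManinTrivialityGeFive (p : ℕ) : Prop :=
  ∀ (W W₂ : WeierstrassCurve ℚ) [W.IsElliptic] [W.IsGloballyMinimal] [W₂.IsElliptic]
    [W₂.IsGloballyMinimal] [NeZero (W.conductorNorm ℤ)]
    (D : ModularParametrizationData W (W.conductorNorm ℤ))
    (D₂ : ModularParametrizationData W₂ (W.conductorNorm ℤ)) (_φ : WeierstrassCurve.Isogeny W W₂),
    p.Prime → 5 ≤ p → (∀ z ∈ D.L.lattice, ∃ w ∈ periodLattice D.f, z = D.c * w) →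
    (∀ D₃ : ModularParametrizationData W₂ (W.conductorNorm ℤ), D₂.deg ≤ D₃.deg) →
    (p : ℤ) ^ 2 ∣ W.conductorNorm ℤ →
      padicValInt p D₂.c = padicValInt p D.c

/-- **Candidate E-imc-14 `NonSquarefreeNoTameGain q` (cell bsd-f2-manin, MEMO-imc §11; the SQUAREFREE
DICHOTOMY — the sharpest empirical law of the g3 census; NOT in print, nothing asserted):** if the conductor
`N(W)` is NOT squarefree (the class has an additive prime somewhere) then at every prime `q` at which `W`
is NOT additive (`q² ∤ N`: good or multiplicative `q`, any size) the Manin `q`-part is constant on the class: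
`v_q c(D₂) = v_q c(D)` for `D` lattice-optimal (conductor level) and `D₂` a minimal-degree datum of the
isogenous (`_φ`, decorative) globally minimal `W₂` at the same level.  BC5: all 165 Manin gains at GOOD
primes (`q = 2`: 127, `3`: 37, `5`: 1 = 11a1 → 11a3) occur at SQUAREFREE `N`; at non-squarefree `N` the
98 870 good `q ∈ {2, 3}` edges, 4 889 good `q ≥ 5` edges and 174 782 multiplicative edges show 0 gains; the
`c > 1` inventory (269 curves = Cremona manin.txt) splits as non-squarefree `N`: 102 curves ALL supported on
additive 2, 3, squarefree `N`: 167 on good 2, 3, 5 — 0 curves with a multiplicative prime in `c`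
(refuter-1 §R10.5).  Stevens–Vatsal reading: a gain at good `q` is `μ_q ⊂ E₀ ∩ Σ(N)`; for `q ≥ 5` an additive
prime `ℓ` of `E₀` forbids a global `μ_q ⊂ E₀`, so the `q ≥ 5` part is Stevens' conjecture + Vatsal Thm 1.11;
the `q ∈ {2, 3}` part is NEW and is where the squarefree hypothesis bites (Byeon–Yhee Thm 1.1(ii) needs `N`
squarefree, `3 ∤ N`).  Why it might fail: a non-squarefree class whose optimal curve contains `μ₃ ⊂ Σ(N)`
with `E₀` additive only at 2 and `3 ∣ #Φ₂` (30 601 good-3 edges at non-squarefree `N`, 0 gains), or `q = 2`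
where only the Ling–Oesterlé structure of `Σ(N)` for `4 ∣ N` can explain the 0 / 68 269.
[cite: Vatsal2005, Thm. 1.1 and Thms 1.10–1.11, Rem. 1.8 (shape only: μ-type subgroups of E₀ inside the Shimura subgroup, J₀ semistable at the primes of n / ℓ ≥ 7; the squarefree dichotomy at q ∈ {2, 3} is NOT in print — cell bsd-f2-manin MEMO-imc.md §11, E-imc-14)]
[cite: ByeonYhee2013, Thm. 1.1(ii) (squarefree N, 3 ∤ N)] [cite: LingOesterle1991, Thm. (structure of Σ(N); via Yoo2017 §3.2)] -/
@[conjecture] def NonSquarefreeNoTameGain (q : ℕ) : Prop :=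
  ∀ (W W₂ : WeierstrassCurve ℚ) [W.IsElliptic] [W.IsGloballyMinimal] [W₂.IsElliptic]
    [W₂.IsGloballyMinimal] [NeZero (W.conductorNorm ℤ)]
    (D : ModularParametrizationData W (W.conductorNorm ℤ))
    (D₂ : ModularParametrizationData W₂ (W.conductorNorm ℤ)) (_φ : WeierstrassCurve.Isogeny W W₂),
    q.Prime → ¬ Squarefree (W.conductorNorm ℤ) → ¬ ((q : ℤ) ^ 2 ∣ W.conductorNorm ℤ) →
    (∀ z ∈ D.L.lattice, ∃ w ∈ periodLattice D.f, z = D.c * w) →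
    (∀ D₃ : ModularParametrizationData W₂ (W.conductorNorm ℤ), D₂.deg ≤ D₃.deg) →
      padicValInt q D₂.c = padicValInt q D.c

end Summit.BirchSwinnertonDyer.Rank1Residual.ManinAdditive

end
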